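import Mathlib

/-!
# Stub `stub_anchorTail` of line `Sketch` (skeleton v6) for crux `TameOrBrodyR4` (stmt-SmoothPoincare4-7826, route SullivanDual)

Asymptotics of the anchor map of a pencil of planes in `ℝ⁴`. The model space `ℝ⁴` carries two
complex coordinate maps `P Q : ℝ⁴ →L[ℝ] ℂ` with `‖x‖² = ‖P x‖² + ‖Q x‖²`. A pencil
`F : ℂ → ℂ → ℝ⁴` has a smooth right inverse `β = (b, ξ)` of its evaluation map (`hβF`); the
anchor map `b = (β ·).1` is honest far out in the `Q`-direction (`b = Q` on `{R ≤ ‖Q‖}`, `hhon`)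
and slab-confined (`‖b‖ < R` on `{‖Q‖ < R}`, `hslab`). Far out in the `P`-direction the members
are graphs `Q = g b P` (`hgF`) of a smooth `g` (`hg`) with `∂_c g → 0` (`hT1`) and `∂_b g → id`
(`hT2`) uniformly. We prove `d(b - Q)_x → 0` as `x → ∞`:

* on `{R < ‖Q x‖}` the difference `b - Q` vanishes identically, so its derivative is `0`;
* on `{‖Q x‖ ≤ R, ‖P x‖ large}` we differentiate the identity `Q y = g (b y) (P y)` (valid near
  `x`) by the chain rule: `Q = D₁ ∘ db + D₂ ∘ P` with `D₁ = ∂_b g`, `D₂ = ∂_c g`; since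
  `‖D₁ - id‖ ≤ ε`, `‖D₂‖ ≤ ε ≤ 1/2` and `‖P‖, ‖Q‖ ≤ 1`, this forces `‖db - Q‖ ≤ 4ε`.

Source: M. Gromov, Invent. Math. 82 (1985) §2.4.A (asymptotics of the pencil chart); here only
implicit differentiation, elementary. Mathlib only (`tendsto_norm_cocompact_atTop`,
`Metric.tendsto_nhds`, `HasFDerivAt.congr_of_eventuallyEq`, `HasFDerivAt.comp`,
`HasFDerivAt.prodMk`, `hasFDerivAt_prodMk_left`, `hasFDerivAt_prodMk_right`,
`HasFDerivAt.unique`, `ContinuousLinearMap.opNorm_le_bound`, `isOpen_lt`).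
-/

open scoped Topology ContDiff
open Filter Set Function Metric

-- the registered namespace `Summit.SmoothPoincare4.SmoothPoincare4.…` repeats a component
set_option linter.dupNamespace false

noncomputable section

namespace Summit.SmoothPoincare4.SmoothPoincare4.Cruxes.TameOrBrodyR4.Sketch

/-- Local notation for the model space `ℝ⁴ = EuclideanSpace ℝ (Fin 4)`. -/
local notation "E4" => EuclideanSpace ℝ (Fin 4)

namespace AnchorTail

/-- From `‖x‖² = ‖P x‖² + ‖Q x‖²`: the first coordinate map `P` is a contraction. -/
theorem norm_fst_le (P Q : E4 →L[ℝ] ℂ) (hPQ : ∀ x : E4, ‖x‖ ^ 2 = ‖P x‖ ^ 2 + ‖Q x‖ ^ 2)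
    (v : E4) : ‖P v‖ ≤ ‖v‖ :=
  (sq_le_sq₀ (norm_nonneg _) (norm_nonneg _)).1 (by nlinarith [hPQ v, sq_nonneg ‖Q v‖])

/-- From `‖x‖² = ‖P x‖² + ‖Q x‖²`: the second coordinate map `Q` is a contraction. -/
theorem norm_snd_le (P Q : E4 →L[ℝ] ℂ) (hPQ : ∀ x : E4, ‖x‖ ^ 2 = ‖P x‖ ^ 2 + ‖Q x‖ ^ 2)
    (v : E4) : ‖Q v‖ ≤ ‖v‖ :=
  (sq_le_sq₀ (norm_nonneg _) (norm_nonneg _)).1 (by nlinarith [hPQ v, sq_nonneg ‖P v‖])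

/-- From `‖x‖² = ‖P x‖² + ‖Q x‖²`: the triangle-type bound `‖x‖ ≤ ‖P x‖ + ‖Q x‖`. -/
theorem norm_le_add (P Q : E4 →L[ℝ] ℂ) (hPQ : ∀ x : E4, ‖x‖ ^ 2 = ‖P x‖ ^ 2 + ‖Q x‖ ^ 2)
    (v : E4) : ‖v‖ ≤ ‖P v‖ + ‖Q v‖ :=
  (sq_le_sq₀ (norm_nonneg _) (by positivity)).1
    (by nlinarith [hPQ v, mul_nonneg (norm_nonneg (P v)) (norm_nonneg (Q v))])

/-- Far out in the `Q`-direction the anchor map is honest (`(β y).1 = Q y` on the open set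
`{R < ‖Q y‖}`), so the derivative of `y ↦ (β y).1 - Q y` vanishes there. -/
theorem fderiv_eq_zero_of_lt (R : ℝ) (Q : E4 →L[ℝ] ℂ) (β : E4 → ℂ × ℂ)
    (hhon : ∀ x, R ≤ ‖Q x‖ → (β x).1 = Q x) (x : E4) (hx : R < ‖Q x‖) :
    fderiv ℝ (fun y => (β y).1 - Q y) x = 0 := by
  have hU : {y : E4 | R < ‖Q y‖} ∈ 𝓝 x :=
    (isOpen_lt continuous_const Q.continuous.norm).mem_nhds hx
  have hev : (fun y => (β y).1 - Q y) =ᶠ[𝓝 x] fun _ => (0 : ℂ) :=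
    Filter.eventually_of_mem hU fun y hy => by
      simp only [Set.mem_setOf_eq] at hy
      simp [hhon y hy.le]
  exact ((hasFDerivAt_const (0 : ℂ) x).congr_of_eventuallyEq hev).fderiv

/-- **Implicit differentiation estimate.** If near `x` the coordinate `Q` factors as
`Q y = g (β y).1 (P y)` with `g` differentiable at `((β x).1, P x)`, if the partial derivatives
of `g` there satisfy `‖∂_c g‖ ≤ ε` and `‖∂_b g - id‖ ≤ ε` with `ε ≤ 1/2`, and if `‖P‖, ‖Q‖ ≤ 1`,
then `‖d((β ·).1 - Q)_x‖ ≤ 4ε`. -/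
theorem norm_fderiv_sub_le {ε : ℝ} (P Q : E4 →L[ℝ] ℂ) (hP : ∀ v, ‖P v‖ ≤ ‖v‖)
    (hQ : ∀ v, ‖Q v‖ ≤ ‖v‖) (β : E4 → ℂ × ℂ) (g : ℂ → ℂ → ℂ) (x : E4)
    (hβx : DifferentiableAt ℝ β x)
    (hgx : DifferentiableAt ℝ (fun p : ℂ × ℂ => g p.1 p.2) ((β x).1, P x))
    (hQg : (Q : E4 → ℂ) =ᶠ[𝓝 x] fun y => g (β y).1 (P y))
    (hε : ε ≤ 1 / 2)
    (h1 : ‖fderiv ℝ (g (β x).1) (P x)‖ ≤ ε)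
    (h2 : ‖fderiv ℝ (fun b' => g b' (P x)) (β x).1 - ContinuousLinearMap.id ℝ ℂ‖ ≤ ε) :
    ‖fderiv ℝ (fun y => (β y).1 - Q y) x‖ ≤ 4 * ε := by
  obtain ⟨db, hdb⟩ : ∃ L, HasFDerivAt (fun y => (β y).1) L x := ⟨_, hβx.fst.hasFDerivAt⟩
  obtain ⟨L, hL⟩ : ∃ L, HasFDerivAt (fun p : ℂ × ℂ => g p.1 p.2) L ((β x).1, P x) :=
    ⟨_, hgx.hasFDerivAt⟩
  -- the two partial derivatives of `g` at `((β x).1, P x)`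
  -- (the inner maps are named explicitly via `f := …` so that the chain rule elaborates)
  have hc₁ : HasFDerivAt (fun b' => g b' (P x)) (L.comp (ContinuousLinearMap.inl ℝ ℂ ℂ))
      (β x).1 :=
    HasFDerivAt.comp (f := fun b' : ℂ => (b', P x)) (β x).1 hL
      (hasFDerivAt_prodMk_left (β x).1 (P x))
  have hc₂ : HasFDerivAt (g (β x).1) (L.comp (ContinuousLinearMap.inr ℝ ℂ ℂ)) (P x) :=
    HasFDerivAt.comp (f := fun c' : ℂ => ((β x).1, c')) (P x) hL
      (hasFDerivAt_prodMk_right (β x).1 (P x))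
  have hD₁ : fderiv ℝ (fun b' => g b' (P x)) (β x).1 =
      L.comp (ContinuousLinearMap.inl ℝ ℂ ℂ) := hc₁.fderiv
  have hD₂ : fderiv ℝ (g (β x).1) (P x) = L.comp (ContinuousLinearMap.inr ℝ ℂ ℂ) := hc₂.fderiv
  -- chain rule for `Q y = g (β y).1 (P y)` near `x`, and uniqueness of the derivative
  have hQd : HasFDerivAt (Q : E4 → ℂ) (L.comp (db.prod P)) x :=
    (HasFDerivAt.comp (f := fun y : E4 => ((β y).1, P y)) x hL
      (hdb.prodMk P.hasFDerivAt)).congr_of_eventuallyEq hQg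
  have hQL : (Q : E4 →L[ℝ] ℂ) = L.comp (db.prod P) := Q.hasFDerivAt.unique hQd
  have hsub : fderiv ℝ (fun y => (β y).1 - Q y) x = db - Q := (hdb.sub Q.hasFDerivAt).fderiv
  rw [hsub]
  have hε0 : 0 ≤ ε := (norm_nonneg _).trans h1
  refine ContinuousLinearMap.opNorm_le_bound _ (by positivity) fun v => ?_
  -- decomposition `Q v = D₁ (db v) + D₂ (P v)`
  have hdec : Q v = fderiv ℝ (fun b' => g b' (P x)) (β x).1 (db v) +
      fderiv ℝ (g (β x).1) (P x) (P v) := by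
    rw [hD₁, hD₂, show Q v = L.comp (db.prod P) v by rw [← hQL]]
    have hv : (db v, P v) = (db v, (0 : ℂ)) + ((0 : ℂ), P v) := by simp
    simp only [ContinuousLinearMap.comp_apply, ContinuousLinearMap.prod_apply,
      ContinuousLinearMap.inl_apply, ContinuousLinearMap.inr_apply]
    rw [hv, map_add]
  set D₁ := fderiv ℝ (fun b' => g b' (P x)) (β x).1
  set D₂ := fderiv ℝ (g (β x).1) (P x)
  have e1 : ‖db v - D₁ (db v)‖ ≤ ε * ‖db v‖ := by
    have : db v - D₁ (db v) = -((D₁ - ContinuousLinearMap.id ℝ ℂ) (db v)) := by simp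
    rw [this, norm_neg]
    exact (D₁ - ContinuousLinearMap.id ℝ ℂ).le_of_opNorm_le h2 (db v)
  have e2 : ‖D₂ (P v)‖ ≤ ε * ‖v‖ :=
    (D₂.le_of_opNorm_le h1 (P v)).trans (mul_le_mul_of_nonneg_left (hP v) hε0)
  have e3 : ‖(db - Q) v‖ ≤ ε * ‖db v‖ + ε * ‖v‖ := by
    have : (db - Q) v = (db v - D₁ (db v)) - D₂ (P v) := by
      rw [sub_apply, hdec]; abel
    rw [this]
    exact (norm_sub_le _ _).trans (add_le_add e1 e2)
  have e4 : ‖db v‖ ≤ ‖(db - Q) v‖ + ‖v‖ :=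
    calc ‖db v‖ = ‖(db - Q) v + Q v‖ := by simp
      _ ≤ ‖(db - Q) v‖ + ‖Q v‖ := norm_add_le _ _
      _ ≤ ‖(db - Q) v‖ + ‖v‖ := by gcongr; exact hQ v
  have e5 : ε * ‖db v‖ ≤ ε * (‖(db - Q) v‖ + ‖v‖) := mul_le_mul_of_nonneg_left e4 hε0
  have e6 : ε * ‖(db - Q) v‖ ≤ 1 / 2 * ‖(db - Q) v‖ :=
    mul_le_mul_of_nonneg_right hε (norm_nonneg _)
  linarith

end AnchorTail

/-- **Stub (anchor tail).** For a pencil of planes in `ℝ⁴` with smooth anchor/parameter map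
`β = (b, ξ)` (right inverse of the evaluation map `F`), honest far out in the `Q`-direction and
slab-confined, whose far members in the `P`-direction are graphs `Q = g b P` of a smooth `g`
with `∂_c g → 0` and `∂_b g → id` uniformly at infinity, the derivative of `b - Q` tends to `0`
at infinity: `‖d((β ·).1 - Q)_x‖ → 0` along the cocompact filter of `ℝ⁴`. -/
theorem stub_anchorTail (R : ℝ) (hR : 0 < R) (P Q : E4 →L[ℝ] ℂ)
    (hPQ : ∀ x : E4, ‖x‖ ^ 2 = ‖P x‖ ^ 2 + ‖Q x‖ ^ 2)
    (F : ℂ → ℂ → E4) (β : E4 → ℂ × ℂ) (g : ℂ → ℂ → ℂ)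
    (hβ : ContDiff ℝ ∞ β) (hβF : ∀ x, F (β x).1 (β x).2 = x)
    (hhon : ∀ x, R ≤ ‖Q x‖ → (β x).1 = Q x)
    (hslab : ∀ x, ‖Q x‖ < R → ‖(β x).1‖ < R)
    (hg : ContDiffOn ℝ ∞ (fun p : ℂ × ℂ => g p.1 p.2) {p | R < ‖p.2‖})
    (hgF : ∀ b ξ : ℂ, R ≤ ‖P (F b ξ)‖ → g b (P (F b ξ)) = Q (F b ξ))
    (hT1 : ∀ ε > 0, ∃ R₂ : ℝ, ∀ b c : ℂ, R₂ ≤ ‖c‖ → ‖fderiv ℝ (g b) c‖ ≤ ε)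
    (hT2 : ∀ ε > 0, ∃ R₂ : ℝ, ∀ b c : ℂ, ‖b‖ ≤ R → R₂ ≤ ‖c‖ →
      ‖fderiv ℝ (fun b' => g b' c) b - ContinuousLinearMap.id ℝ ℂ‖ ≤ ε) :
    Tendsto (fun x => ‖fderiv ℝ (fun y => (β y).1 - Q y) x‖) (cocompact E4) (𝓝 0) := by
  have _ := hR -- positivity of `R` (part of the registered signature) is not needed below
  have hP : ∀ v, ‖P v‖ ≤ ‖v‖ := AnchorTail.norm_fst_le P Q hPQ
  have hQ : ∀ v, ‖Q v‖ ≤ ‖v‖ := AnchorTail.norm_snd_le P Q hPQ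
  -- the open far region in the `P`-direction, where `g` is smooth
  have hUo : IsOpen {p : ℂ × ℂ | R < ‖p.2‖} := isOpen_lt continuous_const continuous_snd.norm
  have hVo : IsOpen {y : E4 | R < ‖P y‖} := isOpen_lt continuous_const P.continuous.norm
  rw [Metric.tendsto_nhds]
  intro ε₀ hε₀
  -- the working accuracy `ε ≤ ε₀ / 8`, `ε ≤ 1 / 2`
  obtain ⟨ε, hε, hεε₀, hε2⟩ : ∃ ε : ℝ, 0 < ε ∧ 8 * ε ≤ ε₀ ∧ ε ≤ 1 / 2 :=
    ⟨min (ε₀ / 8) (1 / 2), by positivity,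
      by linarith [min_le_left (ε₀ / 8) (1 / 2)], min_le_right _ _⟩
  obtain ⟨R₁, hR₁⟩ := hT1 ε hε
  obtain ⟨R₂, hR₂⟩ := hT2 ε hε
  have hfar : ∀ᶠ x in cocompact E4, max (max R₁ R₂) R + R < ‖x‖ :=
    tendsto_norm_cocompact_atTop.eventually (eventually_gt_atTop _)
  filter_upwards [hfar] with x hx
  rw [dist_zero_right, norm_norm]
  rcases lt_or_ge R ‖Q x‖ with hQx | hQx
  · -- honest region: the derivative vanishes
    rw [AnchorTail.fderiv_eq_zero_of_lt R Q β hhon x hQx, norm_zero]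
    exact hε₀
  · -- graph region: implicit differentiation
    have hPx : max (max R₁ R₂) R < ‖P x‖ := by
      linarith [AnchorTail.norm_le_add P Q hPQ x]
    have hRPx : R < ‖P x‖ := (le_max_right _ _).trans_lt hPx
    have hR₁Px : R₁ ≤ ‖P x‖ := ((le_max_left _ _).trans (le_max_left _ _)).trans hPx.le
    have hR₂Px : R₂ ≤ ‖P x‖ := ((le_max_right _ _).trans (le_max_left _ _)).trans hPx.le
    -- the anchor of `x` lies in the closed slab `‖b‖ ≤ R`
    have hb : ‖(β x).1‖ ≤ R := by
      rcases hQx.lt_or_eq with h | h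
      · exact (hslab x h).le
      · rw [hhon x h.ge, h]
    -- `g` is differentiable at `((β x).1, P x)`
    have hgx : DifferentiableAt ℝ (fun p : ℂ × ℂ => g p.1 p.2) ((β x).1, P x) :=
      (hg.contDiffAt (hUo.mem_nhds hRPx)).differentiableAt (by simp)
    -- near `x`, `Q y = g (β y).1 (P y)`
    have hQg : (Q : E4 → ℂ) =ᶠ[𝓝 x] fun y => g (β y).1 (P y) :=
      Filter.eventually_of_mem (hVo.mem_nhds hRPx) fun y hy => by
        simp only [Set.mem_setOf_eq] at hy
        have h := hgF (β y).1 (β y).2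
        rw [hβF] at h
        exact (h hy.le).symm
    calc ‖fderiv ℝ (fun y => (β y).1 - Q y) x‖ ≤ 4 * ε :=
          AnchorTail.norm_fderiv_sub_le P Q hP hQ β g x
            (hβ.contDiffAt.differentiableAt (by simp)) hgx hQg hε2
            (hR₁ (β x).1 (P x) hR₁Px) (hR₂ (β x).1 (P x) hb hR₂Px)
      _ < ε₀ := by linarith
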